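import Summits.AtomisticToContinuum.HydrodynamicLimit.Theorems.CollisionIsometryCLTDiffuseBackwardInfluencePairDefs
import HarnessLib

/-!
# `DiffuseBackwardInfluence`, line `share-nondegeneracy-one-flight`, skeleton v8: the DELAYED re-merge vocabulary
(stmt-AtomisticToContinuum-12950; `--supports` definitions file of the continuation lead c6; adopts the crux strategist's
refinement `Cruxes/DiffuseBackwardInfluence/Lines/delayed-renewal.md` of the lead's v7)

v7 (`…PairDefs.lean`) cut the two-body tail input as `CrossRemergeRareAt` (re-merges of pairs apart AT a slot boundary are rare).
Strategist finding (delayed-renewal card, from `KinResults.md`): that input still contains, with the N-uniform positive coefficient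
`r₁(σ) ≍ σ³` (prompt same-pair re-collision multiplicity), the crux's own conclusion at the `S − 1` interior slot boundaries — a pair
that splits at its host's last collision before `s_r` and re-merges promptly just after `s_r` is a cross-slot re-merge, and the mean
mass of these is `≍ r₁ · u(s_r⁻)`. v8 therefore indexes the tail input by excursion DURATION: only DELAYED re-merges — of pairs apart
throughout the whole previous slot (tag `≤ c − 2` in the marked process; an excursion of `≥ Δ_N/S ≍ n_N/S → ∞` mean free times) —
must be rare (`DelayedRemergeRareAt`, verbatim the strategist's), while RECENT cross-boundary re-merges (tag `c − 1`) cost one unit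
of score deficit each and are paid by the total merge mass (`totalRemFr`, bounded in mean by `RemergeBoundedAt`) in the pathwise
stub. This file: §1 `delayedRemAt`, `delayedRemFr` (VERBATIM the strategist's `Lines/delayed_renewal.lean` §1, re-homed in the
Theorems namespace); §2 `DelayedRemergeRareAt`, `DelayedRemMeasurable`, `@[conjecture] DelayedRemergeRare` (verbatim) and the lead's
pathwise statement `PairPathBoundT` — the strategist's `PairPathBoundD` with the two extra bookkeeping terms
`totalRemFr · 4/(mL) + 2/(mL)` that the lead's AGGREGATED (mass-transport, Markov) accounting of the recent-excursion deficit produces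
(recent re-merges cost total deficit `≤ Σ` re-merge flow `≤ totalRemFr`, the negative part of the tagged deficit costs `≤ totalRemFr + 1`,
both divided by the Markov level `mL`); the composition absorbs them with `RemergeBoundedAt` exactly like `totalRemFr/j₀`.
Definitions + statements only; nothing is asserted.
-/

namespace Summit.AtomisticToContinuum.HydrodynamicLimit.Theorems.DiffuseBackwardInfluenceShare

open scoped BigOperators Topology ENNReal InnerProductSpace Classical
open Filter Set MeasureTheory
open Literature.Analysis.FluidPDE (Config HardSphereFlow collidePair)
open Literature.MathematicalPhysics.KineticTheory (localGibbsLaw hsDiameter)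
open Summit.AtomisticToContinuum.HydrodynamicLimit.Theorems.DiffuseBackwardInfluenceNeg

noncomputable section

/-! ## §1 The canonical DELAYED re-merge functionals (strategist's `delayed_renewal` §1, verbatim) -/

section Canonical

variable (σ : ℝ) (N : ℕ)

/-- DELAYED RE-MERGE MASS at the `t`-th fold step of slot `r` (`r ≥ 1`): the probability that the two conditionally independent
tracers of `src` re-merge at fold step `slotStart r + t` having sat on different particles at EVERY fold step since the start of the
PREVIOUS slot `r − 1` — i.e. the re-merges of v7's no-inflow pair transport `apartFrom` started one slot earlier and run across slot
`r − 1` into slot `r` (their excursion covers the two boundaries `s_{r−1}, s_r`: tag `≤ r − 1` in the marked process, lag `≥ 2`). For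
`r = 0` it degenerates to `crossRemAt` at slot `0`; the sums below start at `r = 1`. -/
def delayedRemAt (y : Cfg N) (src : Fin (N + 1)) (Δ : ℝ) (S r t : ℕ) : ℝ :=
  let len : ℕ := slotStart σ N y Δ S r - slotStart σ N y Δ S (r - 1)
  let n : ℕ := slotStart σ N y Δ S (r - 1) + (len + t)
  ∑ i : Fin (N + 1), ∑ i' : Fin (N + 1), ∑ j' : Fin (N + 1), apartFrom σ N y src Δ S (r - 1) (len + t) i' j' *
    (hopKernel σ N y src n i' i * hopKernel σ N y src n j' i)

/-- DELAYED RE-MERGE FRACTION of the window on the grid with `S` slots: the source average of the total mass of re-merges, during each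
slot `r ∈ [1, S)`, of tracer pairs that were apart throughout the previous slot (pathwise `≤ crossRemFr`). -/
def delayedRemFr (y : Cfg N) (Δ : ℝ) (S : ℕ) : ℝ :=
  ((N + 1 : ℕ) : ℝ)⁻¹ * ∑ src : Fin (N + 1), ∑ r ∈ Finset.Ico 1 S,
    ∑ t ∈ Finset.range (slotStart σ N y Δ S (r + 1) - slotStart σ N y Δ S r), delayedRemAt σ N y src Δ S r t

end Canonical

/-! ## §2 The statements of skeleton v8 -/

/-- THE PAIR-PATH BOUND WITH TAGGED DEFICIT, PATHWISE (no measure theory; the lead's aggregated form of the strategist's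
`PairPathBoundD`): for every configuration `y`, window `Δ > 0`, `η ∈ (0,1)`, `m, L, j₀ ≥ 1` and level `b`, if on each of the `2mL` slots
the idle fraction plus the share-degeneracy score is `≤ b`, then
`ipr ≤ 9 · (2^{j₀} (1 − η(1−η))^{mL − j₀} + totalRemFr · (1/j₀ + 4/(mL)) + 2/(mL) + 2 b + 2 · delayedRemFr_{2mL})`.
Content: `ipr/9` is the source average of the together-mass of the two tracers at the end; in the marked pair process (splits `s`, scores
`t`, separation tag `g`) `Σ 2^{−s}(1 − η(1−η))^{−t}·mass` is non-increasing (`…PairFunctionals.weight_step`); `Σ s·(together mass) ≤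
totalRemFr` (`splitMoment_step`; Markov at `s ≥ j₀`); the TAGGED deficit `Σ (slots resolved − t − s)·mass` (`deficit_step` minus the split
moment) grows only by the idle/degenerate charges (`Σ_r idleFr_r + degFr_r ≤ 2mL·b`) and by `lag × flow ≤ 2mL ×` delayed re-merge flow
(a recent re-merge, lag `1`, is pre-paid by its split); Markov at level `mL` on `{s < j₀}` with the negative part `≤ totalRemFr + 1`. -/
def PairPathBoundT (σ : ℝ) : Prop :=
  ∀ (N : ℕ) (y : Cfg N) (Δ : ℝ), 0 < Δ → ∀ η : ℝ, 0 < η → η < 1 →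
    ∀ m L j₀ : ℕ, 1 ≤ m → 1 ≤ L → 1 ≤ j₀ → ∀ b : ℝ,
      (∀ r : ℕ, r < 2 * m * L → idleFr σ N y Δ (2 * m * L) r + degFr σ N y Δ (2 * m * L) r η ≤ b) →
      ipr σ N y Δ ≤ 9 * ((2 : ℝ) ^ j₀ * (1 - η * (1 - η)) ^ (m * L - j₀) +
        totalRemFr σ N y Δ * (1 / (j₀ : ℝ) + 4 / ((m * L : ℕ) : ℝ)) + 2 / ((m * L : ℕ) : ℝ) + 2 * b +
        2 * delayedRemFr σ N y Δ (2 * m * L))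

/-- DELAYED RE-MERGES ARE RARE (the two-body TAIL input of v8, along the local-Gibbs-EVOLVED law; strategist's statement verbatim): for
every admissible window, `t > 0`, every FIXED grid size `S ≥ 2` and `ε > 0`, eventually the expected delayed re-merge fraction is `≤ ε`.
Content: the two hosts of a tracer pair that has been apart for a full slot (`Δ_N/S`, i.e. `≍ n_N/S → ∞` mean free times) re-touch later
with vanishing probability, uniformly in `N` — transience of the inter-host displacement in `d = 3` at DIVERGING lag; the number of
separations is `O(1)` in mean (`RemergeBoundedAt`). It charges NO prompt re-merge of a pair split just before a boundary, so it contains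
no multiple of the crux functional at interior times. Implied by v7's `CrossRemergeRareAt` (pathwise `delayedRemFr ≤ crossRemFr`). -/
def DelayedRemergeRareAt (σ : ℝ) (a₀ θ₀ : T3 → ℝ) (u₀ : T3 → V3) (Φ : (N : ℕ) → Flow σ N) : Prop :=
  ∀ Δ : ℕ → ℝ, (∀ N, 0 < Δ N) → Tendsto Δ atTop (𝓝 0) →
    Tendsto (fun N : ℕ => Δ N * ((N + 1 : ℕ) : ℝ) ^ ((1 : ℝ) / 3)) atTop atTop →
    ∀ t : ℝ, 0 < t → ∀ S : ℕ, 2 ≤ S → ∀ ε : ℝ, 0 < ε →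
      ∀ᶠ N : ℕ in atTop,
        ∫⁻ z, ENNReal.ofReal (delayedRemFr σ N ((Φ N).flow (t - Δ N) z) (Δ N) S)
            ∂(localGibbsLaw σ a₀ u₀ θ₀ N (Φ N)) ≤ ENNReal.ofReal ε

/-- MEASURABILITY of the delayed re-merge fraction in the configuration (technical input of the v8 composition; provable from
`…PairMeasurable.lean`, p139732). -/
def DelayedRemMeasurable (σ : ℝ) : Prop :=
  ∀ (N : ℕ) (Δ : ℝ) (S : ℕ), Measurable fun y : Cfg N => delayedRemFr σ N y Δ S

/-- **DELAYED RE-MERGES ARE RARE** for every nice profile, below a density threshold `σ₀(profiles)`, for every flow family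
(conjecture-level two-body tail input of v8; weaker than v7's `PairPath.CrossRemergeRare`; strategist's statement verbatim). Not in the
tree or in print: N-uniform transience at diverging lag of the two hosts of a split tracer pair along the deterministic hard-sphere flow
at fixed reduced density. -/
@[conjecture] def DelayedRemergeRare : Prop :=
  ∀ (a₀ θ₀ : T3 → ℝ) (u₀ : T3 → V3), Continuous a₀ → Continuous θ₀ → Continuous u₀ →
    (∀ x, 0 < a₀ x) → (∀ x, 0 < θ₀ x) → ∃ σ₀ : ℝ, 0 < σ₀ ∧ ∀ σ : ℝ, 0 < σ → σ < σ₀ →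
      ∀ Φ : (N : ℕ) → Flow σ N, DelayedRemergeRareAt σ a₀ θ₀ u₀ Φ

/-- Dictionary (registered sub-goal `pairPath_delayedRemFr_eq` of the crux item): the delayed re-merge fraction is the source average of
`delayedRemAt` summed over the slots `r ∈ [1, S)` and their steps (definitional). -/
theorem pairPath_delayedRemFr_eq : ∀ (σ : ℝ) (N : ℕ) (y : Cfg N) (Δ : ℝ) (S : ℕ), delayedRemFr σ N y Δ S = ((N + 1 : ℕ) : ℝ)⁻¹ * ∑ src : Fin (N + 1), ∑ r ∈ Finset.Ico 1 S, ∑ t ∈ Finset.range (slotStart σ N y Δ S (r + 1) - slotStart σ N y Δ S r), delayedRemAt σ N y src Δ S r t :=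
  fun _ _ _ _ _ => rfl

end

end Summit.AtomisticToContinuum.HydrodynamicLimit.Theorems.DiffuseBackwardInfluenceShare
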